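import Summits.QuantumFields.YangMills.Theorems.UnitScaleTiltProp8ChartKernelFlatAssembly
import Summits.QuantumFields.YangMills.Theorems.UnitScaleTiltProp8ChartRemainderColumnLetter
import Summits.QuantumFields.YangMills.Theorems.BalabanUVNodesK0Stub1FlatChartRemainderP
import HarnessLib

/-!
# K0⁷ STUB 1 (`stub_prop8StepCoP13`), sub-target S4b «the (δ∕δA′)V pieces at objects» — **THE (157)♭ KERNEL ROW OF THE DOUBLE-BAR CHART's REMAINDER, GENERIC
# CARRIER `P` AND FIBRE `M_n(ℂ)`**: for every torus `P`, every nested family `D` (`D.k = k`) with the (2.2) collar, the (152) level weights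
# `K0FlatCubeOpsTextP.IsLevWeight P k D w` and every `Y` of weighted size `≤ ρ` inside four k-free windows:
# `‖fderiv ℂ (chartLogFlat η D − D(chartLogFlat η D)(0)) Y (δ_b·M) (J,c)‖ ≤ Θ♭(d,L)·ρ·η·(L^J·(L^{−d})^J)·‖M‖`, `η = L^{−k}` — the `hentry` binder of this seat's
# `θ₀` socket `K0Stub1DtColumnSocket.h73t_of_kernelEntries` (p624155) for k0-s1-w4's ♭ road `Dfun♭ := chartLogFlat − D(chartLogFlat)(0)` (p624568 ∕ p623337)

Cell `pub-ymgap`, width seat `pub-ymgap-k0-s1-w2` g5 (CLAIM-1).  `--kind proof --supports stmt-QuantumFields-20541 --as helper`; count-neutral; def-free.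
[15] = [Balaban1985Variational]; [B7] = [Balaban1985Averaging]; [B6] = [Balaban1984PropagatorsII].

WHY.  After k0-s1-w4's FILES 12′∕13 (`K0Stub1FlatChartRemainderP`, `…SectFWSlotAtRecordFlatChartClosed`) the ♭ W-slot of [15] (157)–(158) at the record displays
exactly ONE analytic letter: `θ₀`, the (73)ᵀ column letter of the transposed derivative `Dt` of `Dfun♭`.  This seat's `θ₀` socket (p624155) reduces it to (i) per-bond
KERNEL ENTRIES `‖fderiv ℂ Dfun♭ A′ (δ_b·a) t‖ ≤ Θ·r·κ(t,b)·‖a‖` and (ii) a weighted column sum of `κ`.  (i) is [B7] Prop. 5 (157) for print's double-bar functional.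
The route `UnitScaleTilt` (cell `ym3-torus`) PROVED it: the engine `ChartKernelFlat.hasDerivAt_logTower_kernel_bound` is generic in `P` and in the matrix fibre `M_n(ℂ)`
(the (149)–(155) tower induction over the one-step double-bar maps, globally small log-field), and `ChartKernelFlatT3.kernel157_flat` reads it at the T³ carrier of a
`T3Family` with the fibre `M₂(ℂ)` through truncation to the read cone.  THIS FILE is the `P`-generic ∕ `M_n(ℂ)`-generic edition of that reading, for the K0 weights
`K0FlatCubeOpsTextP.IsLevWeight` (dag-k0-s1-w3), with dag-n07-w2's generic weighted read bound (`N07ChartRemainderP.weighted_read_bound_of_adm22`) and k0-s1-w4's generic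
hCd♭ (`K0Stub1FlatChartRemainderP.differentiableOn_chartLogFlat_weightedBall_of_adm22`) in place of the route's T³ assembly theorems — same proof, ported and credited.

HOW (as in the T³ file).  Fix the index `i = (J, c)` and the direction `E = δ_b·M`.  Off the read set of `i` (both end-points of `b` in the `J`-blocks `c₋ ∪ c₊`) the
chart at `i` is constant along `Y + tE` (`chartLogFlat_add_of_vanish_on_read`) and so is its flat part (`fderiv_chartLogFlat_zero_apply` + `iterTube_single_eq_zero_of_not_reads`),
so the remainder's derivative vanishes (`fderiv_apply_eq_zero_of_const_line`).  On the read set, truncate `Y` to the read cone (`chartLogFlat_congr`): by the weighted read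
bound the truncation has GLOBAL log-size `r₀ = L·ρ·L^{−J}` in `η`-units, the engine gives the derivative `ηL^J(Q_J E)(c) + k` of the log tower with
`‖k‖ ≤ (A′∕(1 − 2∕L − 1∕12))·(16L^J r₀)·(L^J(L^{−d})^J‖ηM‖)`, hCd♭ identifies it with `fderiv ℂ (chartLogFlat η D) Y E i` (uniqueness of the line derivative), and CERT-2
(`fderiv_chartLogFlat_zero_apply`) removes the tube part.

WHAT IS PROVED (sorry-free; no definition; axioms standard).  Letters: `ℓ := (d+2)L`, `A′ := (2560ℓ∕(400ℓ)⁻¹)·2d∕(L²(Lᵈ)⁻¹)`, `Θ♭ := 16·A′·L∕(1 − 2∕L − 1∕12)`,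
`η := (L⁻¹)^k`, windows `W(ρ) :≡ 121600ℓ²Lρ ≤ 1 ∧ 51200ℓLρ ≤ 1 ∧ A′·16Lρ ≤ 1∕12 ∧ Lρ ≤ 1∕20` (functions of `d, L` only — k-UNIFORM).
* §1 `isOpen_levWeightedBall` (the weighted sup-ball is open).
* §2 ★★★ `kernel157_flat_P` — `P`, `Matrix n n ℂ`, nested `D` with `D.k = k`, `Adm22 D R′ M`, `2L ≤ R′M + 1`, `IsLevWeight P k D w`, `0 ≤ ρ`, `W(ρ)`, `w 1 b‖Y b‖ ≤ ρ`:
  `‖fderiv ℂ (fun A => chartLogFlat η D A − fderiv ℂ (chartLogFlat η D) 0 A) Y (Pi.single b M) i‖ ≤ Θ♭·ρ·η·(L^J·((Lᵈ)⁻¹)^J)·‖M‖` (`J = i.1.1`).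
* §2 ★★ `kernel157_flat_P_eq_zero_of_not_reads` — the same derivative VANISHES when `i` does not read `b` (derivative locality; any `Y` in the hCd♭ ball).
* §3 ★★★ `hentry_flat_P` — the `hentry` binder of `K0Stub1DtColumnSocket.h73t_of_kernelEntries` VERBATIM (two-size hypotheses, `r < ε`) for
  `Dfun♭ := fun A => chartLogFlat η D A − (fderiv ℂ (chartLogFlat η D) 0) A`, ANY `ε` inside the windows `W(ε)`, with `Θ := Θ♭` and the ♭ KERNEL
  `κ♭(t,b) := if t reads b then η·(L^{J(t)}·((Lᵈ)⁻¹)^{J(t)}) else 0` — at an arbitrary `DecidableEq (PBond P 0)` instance (the socket's binder).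
HONEST SCOPE.  A carrier∕fibre∕weights re-typing of the route `UnitScaleTilt`'s T³ reading of its own generic (157) engine (proof ported, credited BY NAME; engines of
dag-n07-w2 and k0-s1-w4 cited BY NAME); nothing of [15] Sects. D–F asserted; the column sum (ii) and the `θ₀` junction are the sequel (`…K0Stub1FlatChartTheta0AtRecord`);
`stub_prop8StepCoP13` ∕ K0⁷ NOT closed; N07 NOT discharged; no summit statement is proved by this seat; counts unmoved (28∕28 · 5∕27); one finite 𝕋⁴ programme at
fixed ε — R4 closes the conditional finite-𝕋⁴ rung `BalabanLadder.UV` only, never the summit; the YM mass gap (Clay) is NOT proved by any of this; nothing continuum ∕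
ℝ⁴ ∕ OS.  No `sorry`, no `def`, no `instance`, no `notation`.

References: [B7] T. Bałaban, CMP **98** (1985) 17–51 (Prop. 5 (147)–(157) pp.40–42); [15] CMP **102** (1985) 277–309 ((44)–(48) p.285, (72)–(73) p.289, (152) p.301,
(156)–(157) p.302); [B6] CMP **96** (1984) 223–250 ((2.2)–(2.3) p.224).
-/

set_option autoImplicit false

noncomputable section

open scoped BigOperators Matrix.Norms.L2Operator
open NormedSpace Metric Filter Topology Set

namespace Summit.QuantumFields.YangMills.Theorems.K0Stub1FlatChartKernel157P

open Literature.MathematicalPhysics.QuantumFieldTheory.Balaban1983to89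
open T4Continuum BlockAveraging MatrixLog
open LatticeFieldCalculus (bondAvg bondAvgIter)
open B5Eq118OneStroke (iterBlockOf)
open B6SectADomainsV1 (Domains)
open B6SectAOperatorsV1 (BondIdx)
open Summit.QuantumFields.YangMills.Theorems.FlatCubeOpsText (Adm22)
open Summit.QuantumFields.YangMills.Theorems.K0FlatCubeOpsTextP (IsLevWeight)
open Summit.QuantumFields.YangMills.Theorems.Prop8Chart (isUnit_exp_I_eta expCfg coe_expCfg)
open Summit.QuantumFields.YangMills.Theorems.Prop8ChartDoubleBar
open Summit.QuantumFields.YangMills.Theorems.ChartKernelTube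
open Summit.QuantumFields.YangMills.Theorems.ChartKernelFlat (hasDerivAt_logTower_kernel_bound)
open Summit.QuantumFields.YangMills.BalabanUVNodes.N07ChartRemainderP (weighted_read_bound_of_adm22)
open Summit.QuantumFields.YangMills.Theorems.K0Stub1FlatChartRemainderP (differentiableOn_chartLogFlat_weightedBall_of_adm22)

variable {P : Params}

/-! ## §1  The weighted sup-ball is open -/

/-- The weighted sup-ball `{Y | ∀ b, w 1 b·‖Y b‖ < R}` of the level weights is open (finite intersection of open half-spaces), any normed fibre. [folklore] -/
theorem isOpen_levWeightedBall {V : Type*} [SeminormedAddCommGroup V] (w : ℕ → PBond P 0 → ℝ) (R : ℝ) :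
    IsOpen {Y : PBond P 0 → V | ∀ b, w 1 b * ‖Y b‖ < R} := by
  have : {Y : PBond P 0 → V | ∀ b, w 1 b * ‖Y b‖ < R} = ⋂ b, {Y : PBond P 0 → V | w 1 b * ‖Y b‖ < R} := by ext Y; simp
  rw [this]
  exact isOpen_iInter_of_finite fun b => isOpen_lt (continuous_const.mul (continuous_apply b).norm) continuous_const

/-! ## §2  [B7] Prop. 5 (157) for the double-bar chart's remainder — generic `P`, fibre `M_n(ℂ)`, K0 level weights -/

section Main

variable {n : Type*} [Fintype n] [DecidableEq n] [Nonempty n]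

/-- ★★★ **THE (157)♭ KERNEL ROW, GENERIC CARRIER AND MATRIX FIBRE** ([Balaban1985Averaging] Prop. 5 (157) for print's double-bar functional, read on the weighted
ball of the (152) weights): for every torus `P`, height `k`, a nested family `D` (`D.k = k`) admissible `Adm22 D R′ M` with `2L ≤ R′M + 1`, the level weights
`K0FlatCubeOpsTextP.IsLevWeight P k D w`, `0 ≤ ρ` within the k-free windows `121600·ℓ²·L·ρ ≤ 1`, `51200·ℓ·L·ρ ≤ 1`, `A′·(16·L·ρ) ≤ 1∕12`, `L·ρ ≤ 1∕20`
(`ℓ = (d+2)L`, `A′ := (2560ℓ∕(400ℓ)⁻¹)·2d∕(L²(Lᵈ)⁻¹)`), every `Y` with `w 1 b·‖Y b‖ ≤ ρ` for all `b`, every fine bond `b`, matrix `M` and index `i = (J, c)`: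
`‖fderiv ℂ (fun A => chartLogFlat η D A − fderiv ℂ (chartLogFlat η D) 0 A) Y (Pi.single b M) i‖ ≤ (16·A′·L∕(1 − 2∕L − 1∕12))·ρ·η·(L^J·((Lᵈ)⁻¹)^J)·‖M‖`, `η = (L⁻¹)^k` —
the `P`∕`M_n(ℂ)`∕K0-weights edition of the route `UnitScaleTilt`'s `ChartKernelFlatT3.kernel157_flat` over its generic engine `ChartKernelFlat.hasDerivAt_logTower_kernel_bound`.
[cite: Balaban1985Averaging, Prop. 5 (157) p.42; Balaban1985Variational, (72)-(73) p.289, (152) p.301, (157) p.302] -/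
theorem kernel157_flat_P (k : ℕ) (D : Domains P) (hDk : D.k = k) {R' Mb : ℕ} (hAdm : Adm22 D R' Mb) (hRM : 2 * P.L ≤ R' * Mb + 1)
    {w : ℕ → PBond P 0 → ℝ} (hw : IsLevWeight P k D w) {ρ : ℝ} (hρ0 : 0 ≤ ρ)
    (hwin1 : 121600 * (((P.d + 2) * P.L : ℕ) : ℝ) ^ 2 * (P.L : ℝ) * ρ ≤ 1)
    (hwin2 : 51200 * (((P.d + 2) * P.L : ℕ) : ℝ) * (P.L : ℝ) * ρ ≤ 1)
    (hwin3 : (2560 * (((P.d + 2) * P.L : ℕ) : ℝ) / (400 * (((P.d + 2) * P.L : ℕ) : ℝ))⁻¹) * (2 * (P.d : ℝ)) /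
        ((P.L : ℝ) ^ 2 * ((P.L : ℝ) ^ P.d)⁻¹) * (16 * ((P.L : ℝ) * ρ)) ≤ 1 / 12)
    (hwin4 : (P.L : ℝ) * ρ ≤ 1 / 20)
    (Y : PBond P 0 → Matrix n n ℂ) (hY : ∀ b, w 1 b * ‖Y b‖ ≤ ρ)
    (b : PBond P 0) (Mm : Matrix n n ℂ) (i : BondIdx D) :
    ‖fderiv ℂ (fun A : PBond P 0 → Matrix n n ℂ =>
          chartLogFlat (((P.L : ℝ)⁻¹) ^ k) D A -
            fderiv ℂ (chartLogFlat (((P.L : ℝ)⁻¹) ^ k) D :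
              (PBond P 0 → Matrix n n ℂ) → BondIdx D → Matrix n n ℂ) 0 A) Y (Pi.single b Mm) i‖ ≤
      (16 * ((2560 * (((P.d + 2) * P.L : ℕ) : ℝ) / (400 * (((P.d + 2) * P.L : ℕ) : ℝ))⁻¹) * (2 * (P.d : ℝ)) /
        ((P.L : ℝ) ^ 2 * ((P.L : ℝ) ^ P.d)⁻¹)) * (P.L : ℝ) / (1 - 2 / (P.L : ℝ) - 1 / 12)) *
        ρ * ((P.L : ℝ)⁻¹) ^ k * ((P.L : ℝ) ^ (i.1.1 : ℕ) * (((P.L : ℝ) ^ P.d)⁻¹) ^ (i.1.1 : ℕ)) * ‖Mm‖ := by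
  -- letters
  set η : ℝ := ((P.L : ℝ)⁻¹) ^ k with hη
  set Lr : ℝ := (P.L : ℝ) with hLr
  set ℓ : ℝ := (((P.d + 2) * P.L : ℕ) : ℝ) with hℓ
  set A' : ℝ := (2560 * ℓ / (400 * ℓ)⁻¹) * (2 * (P.d : ℝ)) / (Lr ^ 2 * (Lr ^ P.d)⁻¹) with hA'
  set J : ℕ := (i.1.1 : ℕ) with hJdef
  set cJ : PBond P J := i.1.2 with hcJ
  set E : PBond P 0 → Matrix n n ℂ := Pi.single b Mm with hE
  set CL : (PBond P 0 → Matrix n n ℂ) → BondIdx D → Matrix n n ℂ := chartLogFlat η D with hCL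
  -- an odd `L > 1` is at least `3`
  have hL3 : 3 ≤ P.L := by obtain ⟨⟨k', hk'⟩, h1⟩ := P.hL; omega
  have hL3r : (3 : ℝ) ≤ Lr := by rw [hLr]; exact_mod_cast hL3
  have hL0 : (0 : ℝ) < Lr := by linarith
  have hη0 : 0 < η := by rw [hη]; positivity
  have hℓ1 : (1 : ℝ) ≤ ℓ := by
    rw [hℓ]; exact_mod_cast Nat.one_le_iff_ne_zero.mpr (Nat.mul_ne_zero (by omega) P.L_pos.ne')
  have hA'0 : 0 ≤ A' := by rw [hA']; positivity
  have hJK : J ≤ P.m + P.K := (Nat.lt_succ_iff.mp i.1.1.isLt).trans D.hk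
  have hden : 0 < 1 - 2 / Lr - 1 / 12 := by
    have : 2 / Lr ≤ 2 / 3 := div_le_div_of_nonneg_left (by norm_num) (by norm_num) hL3r
    linarith
  have hRHS0 : 0 ≤ (16 * A' * Lr / (1 - 2 / Lr - 1 / 12)) * ρ * η * (Lr ^ J * ((Lr ^ P.d)⁻¹) ^ J) * ‖Mm‖ :=
    mul_nonneg (mul_nonneg (mul_nonneg (mul_nonneg (div_nonneg (by positivity) hden.le) hρ0) hη0.le) (by positivity)) (norm_nonneg _)
  -- the flat derivative of the chart along `E` at the index
  have hflat : fderiv ℂ CL 0 E i = ((η : ℂ) * ((P.L : ℕ) : ℂ) ^ J) • bondAvgIter J E cJ := by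
    rw [hCL]; exact fderiv_chartLogFlat_zero_apply η D E i
  -- CASE `ρ = 0`: then `Y = 0` and the remainder's derivative at `0` vanishes
  by_cases hρz : ρ = 0
  · have hY0 : Y = 0 := by
      funext b'
      have h1 : w 1 b' * ‖Y b'‖ ≤ 0 := by rw [← hρz]; exact hY b'
      have hw0 : 0 < w 1 b' := by rw [hw 1 b', pow_one]; positivity
      have : ‖Y b'‖ ≤ 0 := le_of_mul_le_mul_left (by rwa [mul_zero]) hw0
      exact norm_le_zero_iff.mp this
    have hdiff0 : DifferentiableAt ℂ CL 0 := by rw [hCL]; exact differentiableAt_chartLogFlat_zero η D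
    have hrem0 : fderiv ℂ (fun A => CL A - fderiv ℂ CL 0 A) 0 = 0 := by
      have h := ((hdiff0.hasFDerivAt).sub (fderiv ℂ CL 0).hasFDerivAt).fderiv
      rw [sub_self] at h
      exact h
    rw [hY0]
    show ‖fderiv ℂ (fun A => CL A - fderiv ℂ CL 0 A) 0 E i‖ ≤ _
    rw [hrem0]
    have hz : ((0 : (PBond P 0 → Matrix n n ℂ) →L[ℂ] (BondIdx D → Matrix n n ℂ)) E) i = 0 := rfl
    rw [hz, norm_zero]
    exact hRHS0
  have hρpos : 0 < ρ := lt_of_le_of_ne hρ0 (Ne.symm hρz)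
  -- differentiability at `Y` (hCd♭ on the weighted ball of radius `2ρ`, k0-s1-w4's generic edition)
  have hball : ∀ b', w 1 b' * ‖Y b'‖ < 2 * ρ := fun b' => (hY b').trans_lt (by linarith)
  have hRball : 60800 * (((P.d + 2) * P.L : ℕ) : ℝ) ^ 2 * (P.L : ℝ) * (2 * ρ) ≤ 1 := by
    have : 60800 * ℓ ^ 2 * (P.L : ℝ) * (2 * ρ) = 121600 * ℓ ^ 2 * (P.L : ℝ) * ρ := by ring
    rw [this]; exact hwin1
  have hdiffY : DifferentiableAt ℂ CL Y := by
    have hOn := differentiableOn_chartLogFlat_weightedBall_of_adm22 (𝔸 := Matrix n n ℂ) k D hDk hAdm hRM hw hRball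
    rw [hCL]
    exact hOn.differentiableAt ((isOpen_levWeightedBall w (2 * ρ)).mem_nhds hball)
  have hdiffRem : DifferentiableAt ℂ (fun A => CL A - fderiv ℂ CL 0 A) Y := hdiffY.sub (fderiv ℂ CL 0).differentiableAt
  -- CASE `b` not read by the index: derivative locality
  by_cases hread : (iterBlockOf J b.src = cJ.src ∨ iterBlockOf J b.src = cJ.tgt) ∧ (iterBlockOf J b.tgt = cJ.src ∨ iterBlockOf J b.tgt = cJ.tgt)
  swap
  · have hzero : fderiv ℂ (fun A => CL A - fderiv ℂ CL 0 A) Y E i = 0 := by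
      refine ChartRemainderColumnLetter.fderiv_apply_eq_zero_of_const_line (fun A => CL A - fderiv ℂ CL 0 A) Y E i hdiffRem fun t => ?_
      have htube : bondAvgIter J E cJ = 0 := by
        have h := iterTube_single_eq_zero_of_not_reads (V := Matrix n n ℂ) hJK b Mm cJ hread
        rw [hE]
        have hL : (P.L : ℝ) ^ J ≠ 0 := pow_ne_zero _ (Nat.cast_ne_zero.mpr P.L_pos.ne')
        exact (smul_eq_zero.mp h).resolve_left hL
      have hlin : fderiv ℂ CL 0 (Y + t • E) i = fderiv ℂ CL 0 Y i := by
        rw [map_add, map_smul, Pi.add_apply, Pi.smul_apply, hflat, htube, smul_zero, smul_zero, add_zero]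
      have hchart : CL (Y + t • E) i = CL Y i := by
        rw [hCL]
        exact chartLogFlat_add_of_vanish_on_read η D Y (t • E) i fun b' hbs hbt => by
          have hb' : b' ≠ b := by rintro rfl; exact hread ⟨hbs, hbt⟩
          rw [Pi.smul_apply, hE, Pi.single_eq_of_ne hb', smul_zero]
      simp only [Pi.sub_apply, hlin, hchart]
    show ‖fderiv ℂ (fun A => CL A - fderiv ℂ CL 0 A) Y E i‖ ≤ _
    rw [hzero, norm_zero]
    exact hRHS0
  -- CASE `b` read by the index: truncate `Y` to the read cone and run the generic (157)
  set Ytr : PBond P 0 → Matrix n n ℂ := fun b' =>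
    if (iterBlockOf J b'.src = cJ.src ∨ iterBlockOf J b'.src = cJ.tgt) ∧ (iterBlockOf J b'.tgt = cJ.src ∨ iterBlockOf J b'.tgt = cJ.tgt) then Y b' else 0 with hYtr
  set r₀ : ℝ := Lr * ρ * (Lr ^ J)⁻¹ with hr₀
  have hr₀pos : 0 < r₀ := by rw [hr₀]; positivity
  -- the global log size of the truncation
  have hYtrSize : ∀ b', ‖((η : ℂ) • Ytr) b'‖ ≤ r₀ := by
    intro b'
    rw [Pi.smul_apply]
    by_cases hb' : (iterBlockOf J b'.src = cJ.src ∨ iterBlockOf J b'.src = cJ.tgt) ∧ (iterBlockOf J b'.tgt = cJ.src ∨ iterBlockOf J b'.tgt = cJ.tgt)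
    · have hval : Ytr b' = Y b' := by simp only [hYtr, if_pos hb']
      rw [hval, norm_smul, Complex.norm_real, Real.norm_of_nonneg hη0.le]
      -- `η·Lʲ·‖Y b′‖ ≤ L·ρ` from the weighted-ball letter (with every slack `δ > 0`)
      have hle : η * Lr ^ J * ‖Y b'‖ ≤ Lr * ρ := by
        refine le_of_forall_pos_lt_add fun δ hδ => ?_
        have hA : ∀ b'', w 1 b'' * ‖Y b''‖ < ρ + δ / Lr := fun b'' => (hY b'').trans_lt (by have := div_pos hδ hL0; linarith)
        have h := weighted_read_bound_of_adm22 k D hDk hAdm hRM hw hA i b' hb'.1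
        have : (P.L : ℝ) * (ρ + δ / (P.L : ℝ)) = (P.L : ℝ) * ρ + δ := by rw [mul_add, mul_div_cancel₀ _ hL0.ne']
        rw [hη, hLr]; linarith [this ▸ h]
      calc η * ‖Y b'‖ = η * Lr ^ J * ‖Y b'‖ * (Lr ^ J)⁻¹ := by field_simp
        _ ≤ Lr * ρ * (Lr ^ J)⁻¹ := mul_le_mul_of_nonneg_right hle (by positivity)
    · have hval : Ytr b' = 0 := by simp only [hYtr, if_neg hb']
      rw [hval, smul_zero, norm_zero]; exact hr₀pos.le
  -- windows of the generic theorem in terms of `r₀ ≤ Lρ`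
  have hLJ1 : (Lr ^ J)⁻¹ ≤ 1 := inv_le_one_of_one_le₀ (one_le_pow₀ (by linarith))
  have hr₀le : Lr ^ J * r₀ = Lr * ρ := by rw [hr₀]; field_simp
  have hr₀le' : r₀ ≤ Lr * ρ := by
    rw [hr₀]; exact mul_le_of_le_one_right (by positivity) hLJ1
  have hr20 : r₀ ≤ 1 / 20 := hr₀le'.trans hwin4
  have hbud : 121600 * ℓ ^ 2 * (P.L : ℝ) ^ J * r₀ ≤ 1 := by
    rw [← hLr, mul_assoc (121600 * ℓ ^ 2), hr₀le, ← mul_assoc]; exact hwin1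
  have hRb : 51200 * ℓ * (P.L : ℝ) ^ J * r₀ ≤ 1 := by
    rw [← hLr, mul_assoc (51200 * ℓ), hr₀le, ← mul_assoc]; exact hwin2
  have hδ : (2560 * ℓ / (400 * ℓ)⁻¹) * (2 * (P.d : ℝ)) / ((P.L : ℝ) ^ 2 * ((P.L : ℝ) ^ P.d)⁻¹) * (16 * ((P.L : ℝ) ^ J * r₀)) ≤ 1 / 12 := by
    rw [← hLr, hr₀le]; exact hwin3
  -- the generic (157) on the truncation
  obtain ⟨kk, hk, hderk⟩ := hasDerivAt_logTower_kernel_bound (n := n) hL3 hJK η Ytr b Mm cJ hr₀pos hr20 hYtrSize hbud hRb hδ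
  -- the chart along `Y + tE` at the index IS the log tower of the truncation along `Ytr + tE`
  have hfun : (fun t : ℂ => CL (Y + t • E) i) = fun t : ℂ => (-Complex.I) • mlog (((dbarIterU J (expCfg η (Ytr + t • (Pi.single b Mm : PBond P 0 → Matrix n n ℂ))) cJ :
      (Matrix n n ℂ)ˣ) : Matrix n n ℂ)) := by
    funext t
    rw [hCL, chartLogFlat_congr η D i (A := Y + t • E) (A' := Ytr + t • (Pi.single b Mm : PBond P 0 → Matrix n n ℂ)) fun b' hbs hbt => ?_,
      chartLogFlat_apply]
    have hb' : (iterBlockOf J b'.src = cJ.src ∨ iterBlockOf J b'.src = cJ.tgt) ∧ (iterBlockOf J b'.tgt = cJ.src ∨ iterBlockOf J b'.tgt = cJ.tgt) := ⟨hbs, hbt⟩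
    have hval : Ytr b' = Y b' := (congrFun hYtr b').trans (if_pos hb')
    rw [Pi.add_apply, Pi.add_apply, hval, hE]
  -- the derivative of the chart along the line, read through hCd♭
  have hline : HasDerivAt (fun t : ℂ => Y + t • E) E 0 := by
    have h := ((hasDerivAt_id (0 : ℂ)).smul_const E).const_add Y
    rwa [one_smul] at h
  have hcomp : HasDerivAt (fun t : ℂ => CL (Y + t • E)) (fderiv ℂ CL Y E) 0 := by
    have hY0 : (fun t : ℂ => Y + t • E) 0 = Y := by simp only [zero_smul, add_zero]
    have hF : HasFDerivAt CL (fderiv ℂ CL Y) ((fun t : ℂ => Y + t • E) 0) := by rw [hY0]; exact hdiffY.hasFDerivAt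
    exact hF.comp_hasDerivAt (0 : ℂ) hline
  have hcompi : HasDerivAt (fun t : ℂ => CL (Y + t • E) i) (fderiv ℂ CL Y E i) 0 := (hasDerivAt_pi.mp hcomp) i
  rw [hfun] at hcompi
  have huniq : fderiv ℂ CL Y E i = ((η : ℂ) * ((P.L : ℕ) : ℂ) ^ J) • bondAvgIter J E cJ + kk := by
    rw [hE]; exact hcompi.unique hderk
  -- the remainder's derivative at `Y` along `E` at the index is `k`
  have hrem : fderiv ℂ (fun A => CL A - fderiv ℂ CL 0 A) Y E i = kk := by
    have h1 : fderiv ℂ (fun A => CL A - fderiv ℂ CL 0 A) Y = fderiv ℂ CL Y - fderiv ℂ CL 0 :=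
      ((hdiffY.hasFDerivAt).sub (fderiv ℂ CL 0).hasFDerivAt).fderiv
    rw [h1]
    show (fderiv ℂ CL Y E - fderiv ℂ CL 0 E) i = kk
    rw [Pi.sub_apply, huniq, hflat, add_sub_cancel_left]
  show ‖fderiv ℂ (fun A => CL A - fderiv ℂ CL 0 A) Y E i‖ ≤ _
  rw [hrem]
  refine hk.trans (le_of_eq ?_)
  -- bookkeeping of the constant: `L^J r₀ = Lρ`, `‖η•M‖ = η‖M‖`
  have hnM : ‖(η : ℂ) • Mm‖ = η * ‖Mm‖ := by rw [norm_smul, Complex.norm_real, Real.norm_of_nonneg hη0.le]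
  rw [hA', ← hLr, hr₀le, hnM]
  ring

/-- ★★ **DERIVATIVE LOCALITY OF THE ♭ REMAINDER**: if the index `i = (J, c)` does NOT read the fine bond `b` (not both end-points of `b` in the `J`-blocks `c₋ ∪ c₊`),
then `fderiv ℂ (chartLogFlat η D − D(chartLogFlat η D)(0)) Y (Pi.single b M) i = 0` for every `Y` in the hCd♭ ball `{Y | ∀ b, w 1 b·‖Y b‖ < R}`, `60800ℓ²LR ≤ 1`
(two-block locality of the double-bar average `chartLogFlat_add_of_vanish_on_read` + CERT-2 `fderiv_chartLogFlat_zero_apply` + the tube support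
`iterTube_single_eq_zero_of_not_reads`). [cite: Balaban1985Averaging, (110) p.34, (147) p.40; Balaban1984PropagatorsI, (1.18) p.20] -/
theorem kernel157_flat_P_eq_zero_of_not_reads (k : ℕ) (D : Domains P) (hDk : D.k = k) {R' Mb : ℕ} (hAdm : Adm22 D R' Mb) (hRM : 2 * P.L ≤ R' * Mb + 1)
    {w : ℕ → PBond P 0 → ℝ} (hw : IsLevWeight P k D w) {R : ℝ} (hR : 60800 * (((P.d + 2) * P.L : ℕ) : ℝ) ^ 2 * (P.L : ℝ) * R ≤ 1)
    (Y : PBond P 0 → Matrix n n ℂ) (hY : ∀ b, w 1 b * ‖Y b‖ < R)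
    (b : PBond P 0) (Mm : Matrix n n ℂ) (i : BondIdx D)
    (hread : ¬ ((iterBlockOf (i.1.1 : ℕ) b.src = i.1.2.src ∨ iterBlockOf (i.1.1 : ℕ) b.src = i.1.2.tgt) ∧
      (iterBlockOf (i.1.1 : ℕ) b.tgt = i.1.2.src ∨ iterBlockOf (i.1.1 : ℕ) b.tgt = i.1.2.tgt))) :
    fderiv ℂ (fun A : PBond P 0 → Matrix n n ℂ =>
          chartLogFlat (((P.L : ℝ)⁻¹) ^ k) D A -
            fderiv ℂ (chartLogFlat (((P.L : ℝ)⁻¹) ^ k) D :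
              (PBond P 0 → Matrix n n ℂ) → BondIdx D → Matrix n n ℂ) 0 A) Y (Pi.single b Mm) i = 0 := by
  set η : ℝ := ((P.L : ℝ)⁻¹) ^ k with hη
  set J : ℕ := (i.1.1 : ℕ) with hJdef
  set cJ : PBond P J := i.1.2 with hcJ
  set E : PBond P 0 → Matrix n n ℂ := Pi.single b Mm with hE
  set CL : (PBond P 0 → Matrix n n ℂ) → BondIdx D → Matrix n n ℂ := chartLogFlat η D with hCL
  have hJK : J ≤ P.m + P.K := (Nat.lt_succ_iff.mp i.1.1.isLt).trans D.hk
  have hflat : fderiv ℂ CL 0 E i = ((η : ℂ) * ((P.L : ℕ) : ℂ) ^ J) • bondAvgIter J E cJ := by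
    rw [hCL]; exact fderiv_chartLogFlat_zero_apply η D E i
  have hdiffY : DifferentiableAt ℂ CL Y := by
    have hOn := differentiableOn_chartLogFlat_weightedBall_of_adm22 (𝔸 := Matrix n n ℂ) k D hDk hAdm hRM hw hR
    rw [hCL]
    exact hOn.differentiableAt ((isOpen_levWeightedBall w R).mem_nhds hY)
  have hdiffRem : DifferentiableAt ℂ (fun A => CL A - fderiv ℂ CL 0 A) Y := hdiffY.sub (fderiv ℂ CL 0).differentiableAt
  show fderiv ℂ (fun A => CL A - fderiv ℂ CL 0 A) Y E i = 0
  refine ChartRemainderColumnLetter.fderiv_apply_eq_zero_of_const_line (fun A => CL A - fderiv ℂ CL 0 A) Y E i hdiffRem fun t => ?_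
  have htube : bondAvgIter J E cJ = 0 := by
    have h := iterTube_single_eq_zero_of_not_reads (V := Matrix n n ℂ) hJK b Mm cJ hread
    rw [hE]
    have hL : (P.L : ℝ) ^ J ≠ 0 := pow_ne_zero _ (Nat.cast_ne_zero.mpr P.L_pos.ne')
    exact (smul_eq_zero.mp h).resolve_left hL
  have hlin : fderiv ℂ CL 0 (Y + t • E) i = fderiv ℂ CL 0 Y i := by
    rw [map_add, map_smul, Pi.add_apply, Pi.smul_apply, hflat, htube, smul_zero, smul_zero, add_zero]
  have hchart : CL (Y + t • E) i = CL Y i := by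
    rw [hCL]
    exact chartLogFlat_add_of_vanish_on_read η D Y (t • E) i fun b' hbs hbt => by
      have hb' : b' ≠ b := by rintro rfl; exact hread ⟨hbs, hbt⟩
      rw [Pi.smul_apply, hE, Pi.single_eq_of_ne hb', smul_zero]
  simp only [Pi.sub_apply, hlin, hchart]

end Main

/-! ## §3  The `hentry` binder of the `θ₀` socket (`K0Stub1DtColumnSocket.h73t_of_kernelEntries`) for `Dfun♭`, with the ♭ kernel `κ♭` -/

section Entry

variable {n : Type*} [Fintype n] [DecidableEq n] [Nonempty n]

/-- ★★★ **`hentry♭`: THE KERNEL-ENTRY FAMILY OF THE `θ₀` SOCKET FOR THE ♭ CHART's REMAINDER** — the `hentry` binder of `K0Stub1DtColumnSocket.h73t_of_kernelEntries`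
(p624155) VERBATIM, at any `DecidableEq (PBond P 0)` instance, for `Dfun♭ := fun A => chartLogFlat η D A − (fderiv ℂ (chartLogFlat η D) 0) A` (k0-s1-w4's p624568 ∕
p623337 road), with `Θ := Θ♭ = 16·A′·L∕(1 − 2∕L − 1∕12)` and the ♭ KERNEL `κ♭(t,b) := if t reads b then η·(L^{J(t)}·((Lᵈ)⁻¹)^{J(t)}) else 0` (`η = (L⁻¹)^k`), on EVERY
radius `ε` inside the four k-free windows (`121600ℓ²Lε ≤ 1`, `51200ℓLε ≤ 1`, `A′·16Lε ≤ 1∕12`, `Lε ≤ 1∕20`): for every `A′` with both (152) sizes `≤ r < ε`, every fine bond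
`b`, matrix `a` and index `t`, `‖fderiv ℂ Dfun♭ A′ (Pi.single b a) t‖ ≤ Θ♭·r·κ♭(t,b)·‖a‖` (§2 on the read set, §2's locality off it; only the sup-size is used).
[cite: Balaban1985Averaging, Prop. 5 (157) p.42; Balaban1985Variational, (72)-(73) p.289, (152) p.301, (157) p.302] -/
theorem hentry_flat_P [DecidableEq (PBond P 0)] (k : ℕ) (D : Domains P) (hDk : D.k = k) {R' Mb : ℕ} (hAdm : Adm22 D R' Mb)
    (hRM : 2 * P.L ≤ R' * Mb + 1) {w : ℕ → PBond P 0 → ℝ} (hw : IsLevWeight P k D w) {ε : ℝ}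
    (hwin1 : 121600 * (((P.d + 2) * P.L : ℕ) : ℝ) ^ 2 * (P.L : ℝ) * ε ≤ 1)
    (hwin2 : 51200 * (((P.d + 2) * P.L : ℕ) : ℝ) * (P.L : ℝ) * ε ≤ 1)
    (hwin3 : (2560 * (((P.d + 2) * P.L : ℕ) : ℝ) / (400 * (((P.d + 2) * P.L : ℕ) : ℝ))⁻¹) * (2 * (P.d : ℝ)) /
        ((P.L : ℝ) ^ 2 * ((P.L : ℝ) ^ P.d)⁻¹) * (16 * ((P.L : ℝ) * ε)) ≤ 1 / 12)
    (hwin4 : (P.L : ℝ) * ε ≤ 1 / 20) :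
    ∀ (A' : PBond P 0 → Matrix n n ℂ) (r : ℝ), (∀ b, w 1 b * ‖A' b‖ ≤ r) →
      (∀ (b : PBond P 0) (ν : Fin P.d), w 2 b * (P.L : ℝ) ^ k * ‖A' ⟨b.src.shift ν, b.dir⟩ - A' b‖ ≤ r) → r < ε →
      ∀ (b : PBond P 0) (a : Matrix n n ℂ) (t : BondIdx D),
        ‖fderiv ℂ (fun A : PBond P 0 → Matrix n n ℂ => chartLogFlat (((P.L : ℝ)⁻¹) ^ k) D A -
            (fderiv ℂ (chartLogFlat (((P.L : ℝ)⁻¹) ^ k) D : (PBond P 0 → Matrix n n ℂ) → BondIdx D → Matrix n n ℂ) 0) A) A' (Pi.single b a) t‖ ≤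
          (16 * ((2560 * (((P.d + 2) * P.L : ℕ) : ℝ) / (400 * (((P.d + 2) * P.L : ℕ) : ℝ))⁻¹) * (2 * (P.d : ℝ)) /
            ((P.L : ℝ) ^ 2 * ((P.L : ℝ) ^ P.d)⁻¹)) * (P.L : ℝ) / (1 - 2 / (P.L : ℝ) - 1 / 12)) * r *
          (if (iterBlockOf (t.1.1 : ℕ) b.src = t.1.2.src ∨ iterBlockOf (t.1.1 : ℕ) b.src = t.1.2.tgt) ∧
                (iterBlockOf (t.1.1 : ℕ) b.tgt = t.1.2.src ∨ iterBlockOf (t.1.1 : ℕ) b.tgt = t.1.2.tgt)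
            then ((P.L : ℝ)⁻¹) ^ k * ((P.L : ℝ) ^ (t.1.1 : ℕ) * (((P.L : ℝ) ^ P.d)⁻¹) ^ (t.1.1 : ℕ)) else 0) * ‖a‖ := by
  intro A' r h0 _ hr b a t
  have hL1 : (1 : ℝ) ≤ P.L := by exact_mod_cast P.L_pos
  have hL0 : (0 : ℝ) < P.L := by linarith
  have hℓ0 : (0 : ℝ) ≤ (((P.d + 2) * P.L : ℕ) : ℝ) := by positivity
  -- `0 ≤ r` from the size hypothesis at any bond
  have hr0 : 0 ≤ r := by
    have hb₀ : 0 ≤ w 1 ⟨fun _ => 0, ⟨0, P.hd⟩⟩ * ‖A' ⟨fun _ => 0, ⟨0, P.hd⟩⟩‖ := by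
      rw [hw 1, pow_one]; exact mul_nonneg (by positivity) (norm_nonneg _)
    exact hb₀.trans (h0 _)
  -- the windows at `ρ := r ≤ ε`
  have hrε : r ≤ ε := hr.le
  have hA'0 : 0 ≤ (2560 * (((P.d + 2) * P.L : ℕ) : ℝ) / (400 * (((P.d + 2) * P.L : ℕ) : ℝ))⁻¹) * (2 * (P.d : ℝ)) /
      ((P.L : ℝ) ^ 2 * ((P.L : ℝ) ^ P.d)⁻¹) := by positivity
  have hw1 : 121600 * (((P.d + 2) * P.L : ℕ) : ℝ) ^ 2 * (P.L : ℝ) * r ≤ 1 :=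
    (mul_le_mul_of_nonneg_left hrε (by positivity)).trans hwin1
  have hw2 : 51200 * (((P.d + 2) * P.L : ℕ) : ℝ) * (P.L : ℝ) * r ≤ 1 :=
    (mul_le_mul_of_nonneg_left hrε (by positivity)).trans hwin2
  have hw3 : (2560 * (((P.d + 2) * P.L : ℕ) : ℝ) / (400 * (((P.d + 2) * P.L : ℕ) : ℝ))⁻¹) * (2 * (P.d : ℝ)) /
        ((P.L : ℝ) ^ 2 * ((P.L : ℝ) ^ P.d)⁻¹) * (16 * ((P.L : ℝ) * r)) ≤ 1 / 12 :=
    (mul_le_mul_of_nonneg_left (mul_le_mul_of_nonneg_left (mul_le_mul_of_nonneg_left hrε hL0.le) (by norm_num)) hA'0).trans hwin3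
  have hw4 : (P.L : ℝ) * r ≤ 1 / 20 := (mul_le_mul_of_nonneg_left hrε hL0.le).trans hwin4
  by_cases hread : (iterBlockOf (t.1.1 : ℕ) b.src = t.1.2.src ∨ iterBlockOf (t.1.1 : ℕ) b.src = t.1.2.tgt) ∧
      (iterBlockOf (t.1.1 : ℕ) b.tgt = t.1.2.src ∨ iterBlockOf (t.1.1 : ℕ) b.tgt = t.1.2.tgt)
  · rw [if_pos hread]
    have h := kernel157_flat_P (n := n) k D hDk hAdm hRM hw hr0 hw1 hw2 hw3 hw4 A' h0 b a t
    calc _ ≤ _ := by convert h using 4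
      _ = _ := by ring
  · rw [if_neg hread, mul_zero, zero_mul]
    -- `A′` lies in the hCd♭ ball of radius `ε` (`60800ℓ²Lε ≤ 1`)
    have hball : ∀ b', w 1 b' * ‖A' b'‖ < ε := fun b' => (h0 b').trans_lt hr
    have hRε : 60800 * (((P.d + 2) * P.L : ℕ) : ℝ) ^ 2 * (P.L : ℝ) * ε ≤ 1 := by
      have hε0 : 0 ≤ ε := hr0.trans hrε
      nlinarith [hwin1, mul_nonneg (mul_nonneg hℓ0 hℓ0) (mul_nonneg hL0.le hε0)]
    have h := kernel157_flat_P_eq_zero_of_not_reads (n := n) k D hDk hAdm hRM hw hRε A' hball b a t hread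
    have h' : fderiv ℂ (fun A : PBond P 0 → Matrix n n ℂ => chartLogFlat (((P.L : ℝ)⁻¹) ^ k) D A -
        (fderiv ℂ (chartLogFlat (((P.L : ℝ)⁻¹) ^ k) D : (PBond P 0 → Matrix n n ℂ) → BondIdx D → Matrix n n ℂ) 0) A) A' (Pi.single b a) t = 0 := by
      convert h using 3
    rw [h', norm_zero]

end Entry

end Summit.QuantumFields.YangMills.Theorems.K0Stub1FlatChartKernel157P

end
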